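import Mathlib
import Literature.Combinatorics.Optimization.PseudoDensityFourier
import HarnessLib

/-!
# The dual characterization of `ε`-approximate degree (Bun–Thaler 2013, Theorem 1)

Source (read first-hand 2026-08-28, held text `paper:arxiv-1302.6191`, §2–2.1, p. 4): M. Bun,
J. Thaler, *Dual lower bounds for approximate degree and Markov–Bernstein inequalities*, ICALP 2013 /
Information and Computation; arXiv:1302.6191 [BunThaler2013].

Printed statements (verbatim up to notation):

* §2 (p. 4): "The `ε`-approximate degree of a function `f : {−1,1}ⁿ → {−1,1}`, denoted `deg_ε(f)`, is
  the minimum (total) degree of any real polynomial `p` such that `‖p − f‖_∞ ≤ ε`, i.e.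
  `|p(x) − f(x)| ≤ ε` for all `x ∈ {−1,1}ⁿ`."
* §2.1, the primal LP (minimise `ε` subject to `|f(x) − Σ_{|S|≤d} c_S χ_S(x)| ≤ ε`) and its dual
  (maximise `Σ_x φ(x)f(x)` subject to `Σ_x |φ(x)| = 1`, `Σ_x φ(x)χ_S(x) = 0` for each `|S| ≤ d`), and
  **Theorem 1** (p. 4, "Strong LP-duality yields the following well-known dual characterization of
  approximate degree (cf. [Sherstov, pattern matrix method])"): "Let `f : {−1,1}ⁿ → {−1,1}` be a Boolean
  function. Then `deg_ε(f) > d` if and only if there is a polynomial `φ : {−1,1}ⁿ → ℝ` such that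
  `Σ_x f(x)φ(x) > ε`, `Σ_x |φ(x)| = 1`, and `Σ_x φ(x)χ_S(x) = 0` for each `|S| ≤ d`.  If `φ` satisfies
  [the last condition], we say `φ` has pure high degree `d`. We refer to any feasible solution `φ` to
  the dual LP as a dual polynomial for `f`."

Rendering.  The cube is the tree's `Fin n → Bool` with the Walsh characters
`walsh S x = ∏_{i∈S} (−1)^{x_i}` (`Probability/RandomGraphs/LowDegree.lean`), "`p` has degree `≤ d`"
is `Literature.Combinatorics.Optimization.HasDegreeLE d p` (`PatternMatrixPsdRank.lean`: agrees on
the cube with a polynomial of total degree `≤ d`; equivalently `p̂(S) = 0` for `|S| > d`,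
`hasDegreeLE_iff_cubeFourierCoeff_eq_zero` of `PseudoDensityFourier.lean`), so that
`deg_ε(f) ≤ d` is `HasApproxDegreeLE ε d f` and `deg_ε(f) = approxDegree ε f` (an `sInf`, attained
since every function has degree `≤ n`).  The theorem is typed and PROVED for EVERY real-valued `f`
and every `ε ≥ 0` (the printed `f` is Boolean; the proof is the same LP duality):
`BunThaler2013_thm1 : d < approxDegree ε f ↔ ∃ φ, IsDualPolynomial ε d f φ`, through
`not_hasApproxDegreeLE_iff_exists_dualPolynomial`.  Weak duality (`IsDualPolynomial.not_hasApproxDegreeLE`)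
is the one-line estimate `Σ fφ = Σ (f−p)φ ≤ ε Σ|φ|`, using that a dual polynomial annihilates every
function of degree `≤ d` (`HasPureHighDegree.sum_mul_eq_zero`, Fourier inversion); strong duality
(`exists_dualPolynomial`) separates `f` from the closed convex set
`{g : ∃ p, deg p ≤ d, ‖g − p‖_∞ ≤ ε}` (`geometric_hahn_banach_closed_point`; closedness because it is
`{g : infDist(g, V_d) ≤ ε}` for the finite-dimensional subspace `V_d = degreeLESubmodule n d` in the
sup norm), reads the separating functional as `g ↦ Σ_x g(x)φ₀(x)`, shows `φ₀ ⟂ V_d` (a functional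
bounded above on a subspace vanishes on it) and `ε Σ|φ₀| < Σ fφ₀` (test `g = ε·sign φ₀`), and
normalises.  Also recorded: the unnormalised witness form used in practice
(`not_hasApproxDegreeLE_of_witness`: `φ ⟂ V_d`, `Σ fφ > ε Σ|φ|` suffices) and monotonicity.

Typed for the pnp-psdrank cell (memo LIT-39 (N1): the printed notion next to the cell's (BSM)
question), no named facts, no new notation.
-/

noncomputable section

open Finset Metric
open Literature.Probability.RandomGraphs.LowDegree (walsh)
open Literature.Computability.Complexity.LowDegree (cubeFourierCoeff sum_cubeFourierCoeff_mul_walsh)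
open Literature.Combinatorics.Optimization (HasDegreeLE degreeLESubmodule mem_degreeLESubmodule
  hasDegreeLE_iff_cubeFourierCoeff_eq_zero hasDegreeLE_walsh_of_card_le)

namespace Literature.Computability.Complexity.ApproximateDegree

variable {n : ℕ}

/-! ### Definitions -/

/-- **`deg_ε(f) ≤ d`**: some `p` of degree `≤ d` has `|f(x) − p(x)| ≤ ε` for all `x` ("the minimum
(total) degree of any real polynomial `p` such that `‖p − f‖_∞ ≤ ε`"). [cite: BunThaler2013, §2 (p. 4)] -/
def HasApproxDegreeLE (ε : ℝ) (d : ℕ) (f : (Fin n → Bool) → ℝ) : Prop :=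
  ∃ p : (Fin n → Bool) → ℝ, HasDegreeLE d p ∧ ∀ x, |f x - p x| ≤ ε

/-- **The `ε`-approximate degree `deg_ε(f)`**, the least `d` with `deg_ε(f) ≤ d` (every function on
`{0,1}ⁿ` has degree `≤ n`, so the infimum is attained for `ε ≥ 0`, `hasApproxDegreeLE_self`).
[cite: BunThaler2013, §2 (p. 4)] -/
def approxDegree (ε : ℝ) (f : (Fin n → Bool) → ℝ) : ℕ :=
  sInf {d | HasApproxDegreeLE ε d f}

/-- **`φ` has pure high degree `d`**: `Σ_x φ(x) χ_S(x) = 0` for each `|S| ≤ d` (`φ` is orthogonal to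
every character of degree `≤ d`, i.e. `φ̂(S) = 0` for `|S| ≤ d`). [cite: BunThaler2013, §2.1, Thm 1, eq. (3) (p. 4)] -/
def HasPureHighDegree (d : ℕ) (φ : (Fin n → Bool) → ℝ) : Prop :=
  ∀ S : Finset (Fin n), S.card ≤ d → ∑ x, φ x * walsh S x = 0

/-- **A dual polynomial for `f`** (witnessing `deg_ε(f) > d`): `Σ_x f(x)φ(x) > ε`, `Σ_x |φ(x)| = 1`, and
`φ` has pure high degree `d` — a feasible solution of the dual LP with value `> ε`.
[cite: BunThaler2013, §2.1, Thm 1, eqs. (1)–(3) (p. 4)] -/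
def IsDualPolynomial (ε : ℝ) (d : ℕ) (f φ : (Fin n → Bool) → ℝ) : Prop :=
  ε < ∑ x, f x * φ x ∧ ∑ x, |φ x| = 1 ∧ HasPureHighDegree d φ

/-! ### Elementary properties -/

/-- Monotonicity of `deg_ε(f) ≤ d` in `d` and `ε`. [cite: BunThaler2013, §2 (p. 4)] -/
theorem HasApproxDegreeLE.mono {ε ε' : ℝ} {d d' : ℕ} {f : (Fin n → Bool) → ℝ}
    (h : HasApproxDegreeLE ε d f) (hd : d ≤ d') (hε : ε ≤ ε') : HasApproxDegreeLE ε' d' f := by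
  obtain ⟨p, ⟨P, hP, hPp⟩, hp⟩ := h
  exact ⟨p, ⟨P, hP.trans hd, hPp⟩, fun x => (hp x).trans hε⟩

/-- A function of degree `≤ d` has `deg_ε ≤ d` for every `ε ≥ 0` (take `p = f`). [cite: BunThaler2013, §2 (p. 4)] -/
theorem hasApproxDegreeLE_of_hasDegreeLE {ε : ℝ} (hε : 0 ≤ ε) {d : ℕ} {f : (Fin n → Bool) → ℝ}
    (hf : HasDegreeLE d f) : HasApproxDegreeLE ε d f :=
  ⟨f, hf, fun x => by simpa using hε⟩

/-- Every function on `{0,1}ⁿ` has degree `≤ n` (its Fourier expansion). [cite: BunThaler2013, §2.1 (p. 4: "`p(x) = Σ_{|S| ≤ d} c_S χ_S(x)`")] -/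
theorem hasDegreeLE_card (f : (Fin n → Bool) → ℝ) : HasDegreeLE n f :=
  hasDegreeLE_iff_cubeFourierCoeff_eq_zero.2 fun S hS =>
    absurd (S.card_le_univ.trans_eq (Fintype.card_fin n)) (not_le.2 hS)

/-- Hence `deg_ε(f) ≤ n` for `ε ≥ 0`. [cite: BunThaler2013, §2 (p. 4)] -/
theorem hasApproxDegreeLE_self {ε : ℝ} (hε : 0 ≤ ε) (f : (Fin n → Bool) → ℝ) :
    HasApproxDegreeLE ε n f :=
  hasApproxDegreeLE_of_hasDegreeLE hε (hasDegreeLE_card f)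

/-- `deg_ε(f) ≤ d ↔ HasApproxDegreeLE ε d f` (the infimum is a minimum). [cite: BunThaler2013, §2 (p. 4)] -/
theorem approxDegree_le_iff {ε : ℝ} (hε : 0 ≤ ε) {d : ℕ} {f : (Fin n → Bool) → ℝ} :
    approxDegree ε f ≤ d ↔ HasApproxDegreeLE ε d f := by
  constructor
  · intro h
    have hne : {d | HasApproxDegreeLE ε d f}.Nonempty := ⟨n, hasApproxDegreeLE_self hε f⟩
    exact (Nat.sInf_mem hne).mono h le_rfl
  · intro h
    exact Nat.sInf_le h

/-- `deg_ε(f) > d ↔ ¬ (deg_ε(f) ≤ d)`. [cite: BunThaler2013, §2 (p. 4)] -/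
theorem lt_approxDegree_iff {ε : ℝ} (hε : 0 ≤ ε) {d : ℕ} {f : (Fin n → Bool) → ℝ} :
    d < approxDegree ε f ↔ ¬ HasApproxDegreeLE ε d f := by
  rw [← approxDegree_le_iff hε, not_le]

/-! ### Weak duality -/

/-- A function of pure high degree `d` annihilates every function of degree `≤ d`:
`Σ_x p(x)φ(x) = Σ_S p̂(S) Σ_x χ_S(x)φ(x) = 0` (Fourier inversion; `p̂(S) = 0` for `|S| > d`).
[cite: BunThaler2013, §2.1 (p. 4, the dual constraints)] -/
theorem HasPureHighDegree.sum_mul_eq_zero {d : ℕ} {φ p : (Fin n → Bool) → ℝ}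
    (hφ : HasPureHighDegree d φ) (hp : HasDegreeLE d p) : ∑ x, p x * φ x = 0 := by
  have hcoef := hasDegreeLE_iff_cubeFourierCoeff_eq_zero.1 hp
  calc ∑ x, p x * φ x = ∑ x, (∑ S, cubeFourierCoeff p S * walsh S x) * φ x := by
        refine sum_congr rfl fun x _ => ?_
        rw [sum_cubeFourierCoeff_mul_walsh]
    _ = ∑ x, ∑ S, cubeFourierCoeff p S * (φ x * walsh S x) := by
        refine sum_congr rfl fun x _ => ?_
        rw [sum_mul]
        exact sum_congr rfl fun S _ => by ring
    _ = ∑ S, cubeFourierCoeff p S * ∑ x, φ x * walsh S x := by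
        rw [sum_comm]
        exact sum_congr rfl fun S _ => by rw [mul_sum]
    _ = 0 := by
        refine sum_eq_zero fun S _ => ?_
        by_cases hS : S.card ≤ d
        · rw [hφ S hS, mul_zero]
        · rw [hcoef S (not_le.1 hS), zero_mul]

/-- **Weak duality (the easy direction of Theorem 1):** a dual polynomial of pure high degree `d` with
value `> ε` rules out every `ε`-approximation of degree `≤ d`:
`Σ fφ = Σ (f − p)φ ≤ Σ |f−p||φ| ≤ ε Σ|φ| = ε`. [cite: BunThaler2013, Thm 1 (p. 4)] -/
theorem IsDualPolynomial.not_hasApproxDegreeLE {ε : ℝ} {d : ℕ} {f φ : (Fin n → Bool) → ℝ}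
    (hφ : IsDualPolynomial ε d f φ) : ¬ HasApproxDegreeLE ε d f := by
  rintro ⟨p, hp, hfp⟩
  obtain ⟨hval, hnorm, hpure⟩ := hφ
  have h0 : ∑ x, p x * φ x = 0 := hpure.sum_mul_eq_zero hp
  have h1 : ∑ x, f x * φ x = ∑ x, (f x - p x) * φ x := by
    rw [← sub_zero (∑ x, f x * φ x), ← h0, ← sum_sub_distrib]
    exact sum_congr rfl fun x _ => by ring
  have h2 : ∑ x, (f x - p x) * φ x ≤ ∑ x, ε * |φ x| := by
    refine sum_le_sum fun x _ => ?_
    calc (f x - p x) * φ x ≤ |(f x - p x) * φ x| := le_abs_self _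
      _ = |f x - p x| * |φ x| := abs_mul _ _
      _ ≤ ε * |φ x| := mul_le_mul_of_nonneg_right (hfp x) (abs_nonneg _)
  rw [← mul_sum, hnorm, mul_one] at h2
  linarith

/-- The unnormalised witness form used in lower-bound proofs: any `φ` of pure high degree `d` with
`Σ_x f(x)φ(x) > ε·Σ_x|φ(x)|` shows `deg_ε(f) > d` (normalise by `Σ|φ| > 0`).
[cite: BunThaler2013, Thm 1 and the sentence following it (p. 4)] -/
theorem not_hasApproxDegreeLE_of_witness {ε : ℝ} {d : ℕ} {f φ : (Fin n → Bool) → ℝ}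
    (hpure : HasPureHighDegree d φ) (hval : ε * ∑ x, |φ x| < ∑ x, f x * φ x) :
    ¬ HasApproxDegreeLE ε d f := by
  have hN : 0 < ∑ x, |φ x| := by
    rcases (sum_nonneg fun x (_ : x ∈ (univ : Finset (Fin n → Bool))) => abs_nonneg (φ x)).lt_or_eq with h | h
    · exact h
    · exfalso
      have hz : ∀ x, φ x = 0 := fun x =>
        abs_eq_zero.1 (le_antisymm ((single_le_sum (fun y _ => abs_nonneg (φ y)) (mem_univ x)).trans
          h.symm.le) (abs_nonneg _))
      simp [hz] at hval
  set N := ∑ x, |φ x| with hNdef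
  refine IsDualPolynomial.not_hasApproxDegreeLE (φ := fun x => N⁻¹ * φ x) ⟨?_, ?_, fun S hS => ?_⟩
  · have : ∑ x, f x * (N⁻¹ * φ x) = N⁻¹ * ∑ x, f x * φ x := by
      rw [mul_sum]; exact sum_congr rfl fun x _ => by ring
    rw [this, lt_inv_mul_iff₀ hN]
    linarith
  · have : ∑ x, |N⁻¹ * φ x| = N⁻¹ * ∑ x, |φ x| := by
      rw [mul_sum]; exact sum_congr rfl fun x _ => by rw [abs_mul, abs_of_pos (inv_pos.2 hN)]
    rw [this, inv_mul_cancel₀ hN.ne']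
  · have : ∑ x, N⁻¹ * φ x * walsh S x = N⁻¹ * ∑ x, φ x * walsh S x := by
      rw [mul_sum]; exact sum_congr rfl fun x _ => by ring
    rw [this, hpure S hS, mul_zero]

/-! ### Strong duality -/

/-- The feasible region of the primal at value `ε`, `{g : ∃ p, deg p ≤ d, ‖g − p‖_∞ ≤ ε}`, is the
sublevel set `{g : infDist(g, V_d) ≤ ε}` of the distance to the subspace of degree-`≤ d` functions (sup
norm). [cite: BunThaler2013, §2.1 (p. 4, primal LP)] -/
theorem hasApproxDegreeLE_iff_infDist_le {ε : ℝ} (hε : 0 ≤ ε) {d : ℕ} (g : (Fin n → Bool) → ℝ) :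
    HasApproxDegreeLE ε d g ↔ infDist g (degreeLESubmodule n d : Set ((Fin n → Bool) → ℝ)) ≤ ε := by
  have hnorm : ∀ p : (Fin n → Bool) → ℝ, dist g p ≤ ε ↔ ∀ x, |g x - p x| ≤ ε := by
    intro p
    rw [dist_eq_norm, pi_norm_le_iff_of_nonneg hε]
    simp only [Pi.sub_apply, Real.norm_eq_abs]
  constructor
  · rintro ⟨p, hp, hgp⟩
    exact (infDist_le_dist_of_mem (mem_degreeLESubmodule.2 hp)).trans ((hnorm p).2 hgp)
  · intro h
    have hclosed : IsClosed (degreeLESubmodule n d : Set ((Fin n → Bool) → ℝ)) :=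
      (degreeLESubmodule n d).closed_of_finiteDimensional
    have hne : (degreeLESubmodule n d : Set ((Fin n → Bool) → ℝ)).Nonempty := ⟨0, Submodule.zero_mem _⟩
    obtain ⟨p, hp, hdist⟩ := hclosed.exists_infDist_eq_dist hne g
    exact ⟨p, mem_degreeLESubmodule.1 hp, (hnorm p).1 (hdist ▸ h)⟩

/-- The primal feasible region at value `ε` is convex. [cite: BunThaler2013, §2.1 (p. 4, primal LP)] -/
theorem convex_setOf_hasApproxDegreeLE (ε : ℝ) (d : ℕ) :
    Convex ℝ {g : (Fin n → Bool) → ℝ | HasApproxDegreeLE ε d g} := by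
  intro g₁ h₁ g₂ h₂ a b ha hb hab
  obtain ⟨p₁, hp₁, hg₁⟩ := h₁
  obtain ⟨p₂, hp₂, hg₂⟩ := h₂
  refine ⟨a • p₁ + b • p₂, ?_, fun x => ?_⟩
  · have := (degreeLESubmodule n d).add_mem ((degreeLESubmodule n d).smul_mem a
      (mem_degreeLESubmodule.2 hp₁)) ((degreeLESubmodule n d).smul_mem b (mem_degreeLESubmodule.2 hp₂))
    exact mem_degreeLESubmodule.1 this
  · simp only [Pi.add_apply, Pi.smul_apply, smul_eq_mul]
    calc |a * g₁ x + b * g₂ x - (a * p₁ x + b * p₂ x)| = |a * (g₁ x - p₁ x) + b * (g₂ x - p₂ x)| := by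
          ring_nf
      _ ≤ |a * (g₁ x - p₁ x)| + |b * (g₂ x - p₂ x)| := abs_add_le _ _
      _ = a * |g₁ x - p₁ x| + b * |g₂ x - p₂ x| := by rw [abs_mul, abs_mul, abs_of_nonneg ha, abs_of_nonneg hb]
      _ ≤ a * ε + b * ε := add_le_add (mul_le_mul_of_nonneg_left (hg₁ x) ha) (mul_le_mul_of_nonneg_left (hg₂ x) hb)
      _ = ε := by rw [← add_mul, hab, one_mul]

/-- The primal feasible region at value `ε ≥ 0` is closed. [cite: BunThaler2013, §2.1 (p. 4, primal LP)] -/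
theorem isClosed_setOf_hasApproxDegreeLE {ε : ℝ} (hε : 0 ≤ ε) (d : ℕ) :
    IsClosed {g : (Fin n → Bool) → ℝ | HasApproxDegreeLE ε d g} := by
  have : {g : (Fin n → Bool) → ℝ | HasApproxDegreeLE ε d g} =
      (fun g => infDist g (degreeLESubmodule n d : Set ((Fin n → Bool) → ℝ))) ⁻¹' Set.Iic ε := by
    ext g; exact hasApproxDegreeLE_iff_infDist_le hε g
  rw [this]
  exact isClosed_Iic.preimage (continuous_infDist_pt _)

/-- **Strong duality (the hard direction of Theorem 1):** if no polynomial of degree `≤ d` is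
`ε`-close to `f` (`ε ≥ 0`), a dual polynomial exists — the normal vector of a hyperplane separating
`f` from the closed convex primal feasible region, normalised to `Σ|φ| = 1`.
[cite: BunThaler2013, Thm 1 (p. 4: "Strong LP-duality yields …")] -/
theorem exists_dualPolynomial {ε : ℝ} (hε : 0 ≤ ε) {d : ℕ} {f : (Fin n → Bool) → ℝ}
    (hf : ¬ HasApproxDegreeLE ε d f) : ∃ φ, IsDualPolynomial ε d f φ := by
  classical
  obtain ⟨ℓ, u, hℓK, hℓf⟩ := geometric_hahn_banach_closed_point (convex_setOf_hasApproxDegreeLE ε d)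
    (isClosed_setOf_hasApproxDegreeLE hε d) hf
  -- the functional as a vector: `ℓ g = Σ_x g x * φ₀ x`
  set φ₀ : (Fin n → Bool) → ℝ := fun x => ℓ (fun y => if x = y then 1 else 0) with hφ₀
  have hrep : ∀ g : (Fin n → Bool) → ℝ, ℓ g = ∑ x, g x * φ₀ x := by
    intro g
    have := ℓ.toLinearMap.pi_apply_eq_sum_univ g
    simpa only [ContinuousLinearMap.coe_coe, smul_eq_mul] using this
  -- `0` is feasible, so `0 < u`
  have hu : 0 < u := by
    have h0 : HasApproxDegreeLE ε d (0 : (Fin n → Bool) → ℝ) :=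
      ⟨0, mem_degreeLESubmodule.1 (Submodule.zero_mem _), fun x => by simpa using hε⟩
    simpa using hℓK 0 h0
  -- `ℓ` vanishes on the degree-`≤ d` functions (it is bounded above on that subspace)
  have hvan : ∀ p : (Fin n → Bool) → ℝ, HasDegreeLE d p → ℓ p = 0 := by
    intro p hp
    by_contra hne
    have hmem : HasApproxDegreeLE ε d (((u + 1) / ℓ p) • p) :=
      hasApproxDegreeLE_of_hasDegreeLE hε (mem_degreeLESubmodule.1
        ((degreeLESubmodule n d).smul_mem _ (mem_degreeLESubmodule.2 hp)))
    have hlt := hℓK _ hmem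
    rw [map_smul, smul_eq_mul, div_mul_cancel₀ _ hne] at hlt
    linarith
  have hpure : HasPureHighDegree d φ₀ := by
    intro S hS
    have := hvan (walsh S) (hasDegreeLE_walsh_of_card_le hS)
    rw [hrep] at this
    simpa only [mul_comm (walsh S _)] using this
  -- testing against `ε · sign φ₀`: `ε Σ|φ₀| < u`
  have hsign : ε * ∑ x, |φ₀ x| < u := by
    have hmem : HasApproxDegreeLE ε d (fun x => ε * SignType.sign (φ₀ x)) := by
      refine ⟨0, mem_degreeLESubmodule.1 (Submodule.zero_mem _), fun x => ?_⟩
      simp only [Pi.zero_apply, sub_zero, abs_mul, abs_of_nonneg hε]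
      rcases lt_trichotomy (φ₀ x) 0 with h | h | h
      · rw [sign_neg h]; simp
      · rw [h, sign_zero]; simp [hε]
      · rw [sign_pos h]; simp
    have hlt := hℓK _ hmem
    rw [hrep] at hlt
    have e : ∑ x, ε * (SignType.sign (φ₀ x) : ℝ) * φ₀ x = ε * ∑ x, |φ₀ x| := by
      rw [mul_sum]
      refine sum_congr rfl fun x _ => ?_
      rw [mul_assoc, sign_mul_self]
    linarith [e.symm.le, e.le]
  have hfval : u < ∑ x, f x * φ₀ x := by rwa [hrep] at hℓf
  -- normalise
  have hN : 0 < ∑ x, |φ₀ x| := by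
    rcases (sum_nonneg fun x (_ : x ∈ (univ : Finset (Fin n → Bool))) => abs_nonneg (φ₀ x)).lt_or_eq with h | h
    · exact h
    · exfalso
      have hz : ∀ x, φ₀ x = 0 := fun x =>
        abs_eq_zero.1 (le_antisymm ((single_le_sum (fun y _ => abs_nonneg (φ₀ y)) (mem_univ x)).trans
          h.symm.le) (abs_nonneg _))
      have : ∑ x, f x * φ₀ x = 0 := sum_eq_zero fun x _ => by rw [hz x, mul_zero]
      linarith
  set N := ∑ x, |φ₀ x| with hNdef
  refine ⟨fun x => N⁻¹ * φ₀ x, ?_, ?_, fun S hS => ?_⟩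
  · have e1 : ∑ x, f x * (N⁻¹ * φ₀ x) = N⁻¹ * ∑ x, f x * φ₀ x := by
      rw [mul_sum]; exact sum_congr rfl fun x _ => by ring
    rw [e1, lt_inv_mul_iff₀ hN]
    linarith
  · have e2 : ∑ x, |N⁻¹ * φ₀ x| = N⁻¹ * ∑ x, |φ₀ x| := by
      rw [mul_sum]; exact sum_congr rfl fun x _ => by rw [abs_mul, abs_of_pos (inv_pos.2 hN)]
    rw [e2, inv_mul_cancel₀ hN.ne']
  · have e3 : ∑ x, N⁻¹ * φ₀ x * walsh S x = N⁻¹ * ∑ x, φ₀ x * walsh S x := by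
      rw [mul_sum]; exact sum_congr rfl fun x _ => by ring
    rw [e3, hpure S hS, mul_zero]

/-- **Theorem 1 in `HasApproxDegreeLE` form:** for `ε ≥ 0`, `f` has NO `ε`-approximation of degree
`≤ d` iff a dual polynomial for `f` of pure high degree `d` with value `> ε` exists.
[cite: BunThaler2013, Thm 1 (p. 4)] -/
theorem not_hasApproxDegreeLE_iff_exists_dualPolynomial {ε : ℝ} (hε : 0 ≤ ε) {d : ℕ}
    {f : (Fin n → Bool) → ℝ} : ¬ HasApproxDegreeLE ε d f ↔ ∃ φ, IsDualPolynomial ε d f φ :=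
  ⟨exists_dualPolynomial hε, fun ⟨_, hφ⟩ => hφ.not_hasApproxDegreeLE⟩

/-- **Bun–Thaler 2013, Theorem 1 (dual characterization of approximate degree), for every real `f`
on the cube and every `ε ≥ 0`:** "`deg_ε(f) > d` if and only if there is a polynomial
`φ : {−1,1}ⁿ → ℝ` such that `Σ_x f(x)φ(x) > ε`, `Σ_x |φ(x)| = 1`, and `Σ_x φ(x)χ_S(x) = 0` for each
`|S| ≤ d`."  (Printed for Boolean `f : {−1,1}ⁿ → {−1,1}`; attributed there to strong LP duality,
"cf. [Sherstov, the pattern matrix method]".) [cite: BunThaler2013, Thm 1 (p. 4)] -/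
theorem BunThaler2013_thm1 {ε : ℝ} (hε : 0 ≤ ε) (d : ℕ) (f : (Fin n → Bool) → ℝ) :
    d < approxDegree ε f ↔ ∃ φ, IsDualPolynomial ε d f φ := by
  rw [lt_approxDegree_iff hε, not_hasApproxDegreeLE_iff_exists_dualPolynomial hε]

/-- Pure high degree in Fourier language: `φ̂(S) = 0` for all `|S| ≤ d`. [cite: BunThaler2013, §2.1 (p. 4)] -/
theorem hasPureHighDegree_iff_cubeFourierCoeff {d : ℕ} {φ : (Fin n → Bool) → ℝ} :
    HasPureHighDegree d φ ↔ ∀ S : Finset (Fin n), S.card ≤ d → cubeFourierCoeff φ S = 0 := by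
  unfold HasPureHighDegree cubeFourierCoeff
  refine forall_congr' fun S => forall_congr' fun _ => ?_
  rw [div_eq_zero_iff, or_iff_left (by positivity)]

end Literature.Computability.Complexity.ApproximateDegree

end
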